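import Summits.QuantumFields.GaugeBoot.StrongCouplingTriplePlaquette
import Summits.QuantumFields.GaugeBoot.StrongCouplingCubicSU3Reverse
import HarnessLib

/-!
# Strong coupling from the loop equation: ALL cubic moments of the `SU(N)` plaquette are `O(β)` for `N ≥ 4` (gauge-boot, ADDENDUM 25 part C)

HONEST FRAMING (cell `pub-gaugeboot`, page 1 of every file): the venture produces certified bounds
on lattice expectations at stated coupling, gauge group, dimension and torus size; NOT a mass gap,
NOT a continuum limit, NOT a string tension; NOT Yang–Mills-summit-bearing (barriers
`FixedCouplingUltralocality`, `PerturbativeInvisibility`).  Crude explicit `O(β)` bounds on a finite torus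
`(ℤ/L)^d`, `L ≥ 2`, every real (tree) coupling `β = β_std/N`; no number of the cell's tables is certified here.

## Content

With `t = tr U_P` (`U_P = hol P̃₀`), `t' = tr U_P⁻¹`, `D = tr U_P²`, all expectations in Wilson's measure at `β`:
* MIXED SECTOR (`N ≥ 2`): ★ `norm_integral_trace_mul_reverse_sq_suN_le` **`‖E[t·t'·t']‖ ≤ 7N²(d−1)|β|`** (three-word
  equation with two reverse spectators, `(N + 1/N)E[t t' t'] − 2N E[t'] = O(β)`), its conjugate
  `norm_integral_trace_sq_mul_reverse_suN_le`, and `norm_integral_trace_double_mul_reverse_suN_le`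
  **`‖E[D·t']‖ ≤ 17N(d−1)|β|`** (reverse-spectator identity of the doubly-wound plaquette, ADDENDUM 24);
* HOLOMORPHIC SECTOR (`N ≥ 4`): ★★ `cubicMoments_suN_le` — **`‖E[t³]‖ ≤ 14N²(d−1)|β|`, `‖E[D·t]‖ ≤ 49N(d−1)|β|`,
  `‖E[tr U_P³]‖ ≤ 27N²(d−1)|β|`**: the rows `c·E[t³] + 2E[Dt]`, `c·E[Dt] + E[t³] + E[tr U_P³]`, `c·E[Dt] + 2E[tr U_P³]`
  (`c = N − 3/N`) are all `O(β)` with determinant `c² − 4 = (N²−1)(N²−9)/N²`, nonzero exactly when `N ≠ 3` — for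
  `SU(3)` the kernel is the baryon vertex `E[t³] = 1 + O(β)` (ADDENDUM 24); for `SU(N ≥ 4)` every cubic moment is
  `O(β)` explicitly, whence (`StrongCouplingPlaquetteSUNThird`) the second strong-coupling coefficient vanishes.

References: Yu. Makeenko, *Methods of contemporary gauge theory* (2002) Problem 12.7; M. Creutz, *Quarks, gluons and
lattices* (1983) Ch. 8; J.-M. Drouffe, J.-B. Zuber, Phys. Rept. 102 (1983) §3 (one-plaquette integrals).  `[folklore]`.
-/

noncomputable section

open MeasureTheory Filter Topology NormedSpace
open scoped Matrix.Norms.Frobenius Matrix ComplexConjugate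
open Literature.MathematicalPhysics.QuantumFieldTheory Literature.MathematicalPhysics.QuantumLattice
open Summit.QuantumFields.YangMills.Cruxes.CurvatureAmnesia.WardDefect.SchwingerDyson

namespace Summit.QuantumFields.GaugeBoot

namespace StrongCoupling

variable {d L N : ℕ} [NeZero L]

/-! ## First-order inputs: `E[t]`, `E[t']` -/
/-- `‖E[tr U_P]‖ ≤ 4(d−1)N²|β|/(N²−1)` (`SU(N)`, `N ≥ 2`; the one-step bound). [folklore] -/
theorem norm_integral_trace_plaqWord_suN_le (hN : 2 ≤ N) (hL : (1 : ZMod L) ≠ 0) (β : ℝ) (x : Site d L) {μ ν₀ : Fin d}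
    (hμν₀ : μ ≠ ν₀) :
    ‖∫ U, (fundamentalRep (Fin N) (wordHolonomy U x (plaqWord μ ν₀ true))).trace
        ∂(wilsonMeasure (d := d) (L := L) (fundamentalRep (Fin N)) β)‖ ≤ 4 * ((d : ℝ) - 1) * (N : ℝ) ^ 2 * |β| / ((N : ℝ) ^ 2 - 1) :=
  norm_integral_trace_suN_le (d := d) (L := L) hN β x μ (plaqWord μ ν₀ true) (endpoint_plaqWord x μ ν₀ true)
    (fun U => by simpa using Equipartition.sum_splitTerm_plaqWord (fundamentalRep (Fin N)) hL 1 x hμν₀ U true)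

/-- `‖E[tr U_P⁻¹]‖ ≤ 4(d−1)N²|β|/(N²−1)` (the conjugate). [folklore] -/
theorem norm_integral_trace_plaqWord_reverse_suN_le (hN : 2 ≤ N) (hL : (1 : ZMod L) ≠ 0) (β : ℝ) (x : Site d L)
    {μ ν₀ : Fin d} (hμν₀ : μ ≠ ν₀) :
    ‖∫ U, (fundamentalRep (Fin N) (wordHolonomy U x (plaqWord μ ν₀ true).reverse)).trace
        ∂(wilsonMeasure (d := d) (L := L) (fundamentalRep (Fin N)) β)‖ ≤ 4 * ((d : ℝ) - 1) * (N : ℝ) ^ 2 * |β| / ((N : ℝ) ^ 2 - 1) := by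
  have hconj : ∫ U, (fundamentalRep (Fin N) (wordHolonomy U x (plaqWord μ ν₀ true).reverse)).trace
      ∂(wilsonMeasure (d := d) (L := L) (fundamentalRep (Fin N)) β) =
      conj (∫ U, (fundamentalRep (Fin N) (wordHolonomy U x (plaqWord μ ν₀ true))).trace
        ∂(wilsonMeasure (d := d) (L := L) (fundamentalRep (Fin N)) β)) := by
    rw [← integral_conj]
    exact integral_congr_ae (ae_of_all _ fun U => trace_wordHolonomy_reverse_eq_conj U x _ (endpoint_plaqWord x μ ν₀ true))
  rw [hconj, Complex.norm_conj]
  exact norm_integral_trace_plaqWord_suN_le hN hL β x hμν₀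

/-! ## The mixed sector (`N ≥ 2`) -/
/-- ★ **`‖E[tr U_P · tr U_P⁻¹ · tr U_P⁻¹]‖ ≤ 7N²(d−1)|β|`** (`SU(N)`, `N ≥ 2`, every `L ≥ 2`, every real `β`): the three-word
loop equation of `P̃₀` with spectators `P̃₀⁻¹, P̃₀⁻¹` reads `(N + 1/N)·E[t t' t'] − 2N·E[t'] = O(β)`. [folklore] -/
theorem norm_integral_trace_mul_reverse_sq_suN_le (hN : 2 ≤ N) (hL : (1 : ZMod L) ≠ 0) (β : ℝ) (x : Site d L)
    {μ ν₀ : Fin d} (hμν₀ : μ ≠ ν₀) :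
    ‖∫ U, (fundamentalRep (Fin N) (wordHolonomy U x (plaqWord μ ν₀ true))).trace *
        (fundamentalRep (Fin N) (wordHolonomy U x (plaqWord μ ν₀ true).reverse)).trace *
        (fundamentalRep (Fin N) (wordHolonomy U x (plaqWord μ ν₀ true).reverse)).trace
          ∂(wilsonMeasure (d := d) (L := L) (fundamentalRep (Fin N)) β)‖ ≤ 7 * (N : ℝ) ^ 2 * ((d : ℝ) - 1) * |β| := by
  have hN2 : (2 : ℝ) ≤ N := by exact_mod_cast hN
  have hNpos : (0 : ℝ) < N := by linarith
  have hN21 : (0 : ℝ) < (N : ℝ) ^ 2 - 1 := by nlinarith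
  have hd1 : (0 : ℝ) ≤ (d : ℝ) - 1 := sub_one_nonneg_of_axis μ
  have h := twoSpectators_reverse_identity (d := d) (L := L) (fundamentalLatticeRep N) hL β x hμν₀ 1
    fun i j => sdPairMany_specialUnitaryGroup N β x μ x _ _ _ continuous_const (fun _ _ => rfl) _ (trace_unitDir_one i j)
  have hR := norm_sum_sum_integral_plaqTerm_mul_mul_le (d := d) (L := L) (fundamentalLatticeRep N) β 1 x μ
    (plaqWord μ ν₀ true) x (plaqWord μ ν₀ true).reverse x (plaqWord μ ν₀ true).reverse
  simp only [fundamentalLatticeRep_N, fundamentalLatticeRep_ρ, norm_one] at h hR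
  set A := ∫ U, (fundamentalRep (Fin N) (wordHolonomy U x (plaqWord μ ν₀ true))).trace *
        (fundamentalRep (Fin N) (wordHolonomy U x (plaqWord μ ν₀ true).reverse)).trace *
        (fundamentalRep (Fin N) (wordHolonomy U x (plaqWord μ ν₀ true).reverse)).trace
          ∂(wilsonMeasure (d := d) (L := L) (fundamentalRep (Fin N)) β) with hA
  set T := ∫ U, (fundamentalRep (Fin N) (wordHolonomy U x (plaqWord μ ν₀ true).reverse)).trace
    ∂(wilsonMeasure (d := d) (L := L) (fundamentalRep (Fin N)) β) with hT
  set S := ∑ ν ∈ Finset.univ.erase μ, ∑ ε : Bool,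
        ∫ U, plaqTerm (fundamentalRep (Fin N)) 1 x μ U (plaqWord μ ν₀ true) ν ε *
          ((fundamentalRep (Fin N) (wordHolonomy U x (plaqWord μ ν₀ true).reverse)).trace *
          (fundamentalRep (Fin N) (wordHolonomy U x (plaqWord μ ν₀ true).reverse)).trace)
            ∂(wilsonMeasure (d := d) (L := L) (fundamentalRep (Fin N)) β) with hS
  have h' : ((N : ℂ) + 1 / N) * A - 2 * N * T = -((β / 2 : ℂ) * S) := h
  have hR' : ‖S‖ ≤ ((d : ℝ) - 1) * (2 * (2 * N * (1 + 1) * N * N)) := hR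
  have hT' := norm_integral_trace_plaqWord_reverse_suN_le (d := d) (L := L) hN hL β x hμν₀
  rw [← hT] at hT'
  have hcoef : ((N : ℂ) + 1 / N) = ((((N : ℝ) ^ 2 + 1) / N : ℝ) : ℂ) := by
    have : (N : ℂ) ≠ 0 := by exact_mod_cast hNpos.ne'
    push_cast; field_simp
  have hid : ((((N : ℝ) ^ 2 + 1) / N : ℝ) : ℂ) * A = 2 * (N : ℂ) * T - (β / 2 : ℂ) * S := by
    rw [← hcoef]; linear_combination h'
  have hn := congrArg (fun z : ℂ => ‖z‖) hid
  simp only [norm_mul, Complex.norm_real, Real.norm_eq_abs, abs_of_pos (by positivity : (0 : ℝ) < ((N : ℝ) ^ 2 + 1) / N)] at hn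
  have hle : ((N : ℝ) ^ 2 + 1) / N * ‖A‖ ≤ 2 * N * (4 * ((d : ℝ) - 1) * (N : ℝ) ^ 2 * |β| / ((N : ℝ) ^ 2 - 1)) +
      |β| / 2 * (((d : ℝ) - 1) * (2 * (2 * N * (1 + 1) * N * N))) := by
    rw [hn]
    refine (norm_sub_le _ _).trans (add_le_add ?_ ?_)
    · rw [norm_mul, norm_mul, Complex.norm_ofNat, Complex.norm_natCast]
      exact mul_le_mul_of_nonneg_left hT' (by positivity)
    · rw [norm_mul, norm_half_ofReal]
      exact mul_le_mul_of_nonneg_left hR' (by positivity)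
  -- `8N³/(N²−1) + 4N³ ≤ 7N³ + 7N/… `: round to `7N²`
  have hfrac : 4 * ((d : ℝ) - 1) * (N : ℝ) ^ 2 * |β| / ((N : ℝ) ^ 2 - 1) ≤ 4 / 3 * (((d : ℝ) - 1) * (N : ℝ) ^ 2 * |β|) := by
    rw [div_le_iff₀ hN21]
    have h0 : 0 ≤ ((d : ℝ) - 1) * (N : ℝ) ^ 2 * |β| := by positivity
    have hN4 : (0 : ℝ) ≤ (N : ℝ) ^ 2 - 4 := by nlinarith
    nlinarith [mul_nonneg h0 hN4]
  have hkey : ((N : ℝ) ^ 2 + 1) / N * ‖A‖ ≤ ((N : ℝ) ^ 2 + 1) / N * (7 * (N : ℝ) ^ 2 * ((d : ℝ) - 1) * |β|) := by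
    refine hle.trans ?_
    have h0 : 0 ≤ ((d : ℝ) - 1) * (N : ℝ) ^ 2 * |β| := by positivity
    have e : ((N : ℝ) ^ 2 + 1) / N * (7 * (N : ℝ) ^ 2 * ((d : ℝ) - 1) * |β|) =
        7 * ((N : ℝ) ^ 2 + 1) / N * (((d : ℝ) - 1) * (N : ℝ) ^ 2 * |β|) := by ring
    rw [e]
    have e2 : 7 * ((N : ℝ) ^ 2 + 1) / N = 7 * N + 7 / N := by field_simp
    rw [e2]
    have h7 : (0 : ℝ) ≤ 7 / N * (((d : ℝ) - 1) * (N : ℝ) ^ 2 * |β|) := by positivity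
    have h1 : 2 * (N : ℝ) * (4 * ((d : ℝ) - 1) * (N : ℝ) ^ 2 * |β| / ((N : ℝ) ^ 2 - 1)) ≤
        2 * N * (4 / 3 * (((d : ℝ) - 1) * (N : ℝ) ^ 2 * |β|)) := mul_le_mul_of_nonneg_left hfrac (by positivity)
    have h2 : |β| / 2 * (((d : ℝ) - 1) * (2 * (2 * N * (1 + 1) * N * N))) = 4 * N * (((d : ℝ) - 1) * (N : ℝ) ^ 2 * |β|) := by
      ring
    have h3 : 0 ≤ (N : ℝ) * (((d : ℝ) - 1) * (N : ℝ) ^ 2 * |β|) := by positivity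
    nlinarith
  exact le_of_mul_le_mul_left hkey (by positivity)

/-- ★ **`‖E[tr U_P · tr U_P · tr U_P⁻¹]‖ ≤ 7N²(d−1)|β|`** (the complex conjugate of the previous moment). [folklore] -/
theorem norm_integral_trace_sq_mul_reverse_suN_le (hN : 2 ≤ N) (hL : (1 : ZMod L) ≠ 0) (β : ℝ) (x : Site d L)
    {μ ν₀ : Fin d} (hμν₀ : μ ≠ ν₀) :
    ‖∫ U, (fundamentalRep (Fin N) (wordHolonomy U x (plaqWord μ ν₀ true))).trace *
        (fundamentalRep (Fin N) (wordHolonomy U x (plaqWord μ ν₀ true))).trace *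
        (fundamentalRep (Fin N) (wordHolonomy U x (plaqWord μ ν₀ true).reverse)).trace
          ∂(wilsonMeasure (d := d) (L := L) (fundamentalRep (Fin N)) β)‖ ≤ 7 * (N : ℝ) ^ 2 * ((d : ℝ) - 1) * |β| := by
  have hP : Word.endpoint x (plaqWord μ ν₀ true) = x := endpoint_plaqWord x μ ν₀ true
  have hconj : ∫ U, (fundamentalRep (Fin N) (wordHolonomy U x (plaqWord μ ν₀ true))).trace *
        (fundamentalRep (Fin N) (wordHolonomy U x (plaqWord μ ν₀ true))).trace *
        (fundamentalRep (Fin N) (wordHolonomy U x (plaqWord μ ν₀ true).reverse)).trace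
          ∂(wilsonMeasure (d := d) (L := L) (fundamentalRep (Fin N)) β) =
      conj (∫ U, (fundamentalRep (Fin N) (wordHolonomy U x (plaqWord μ ν₀ true))).trace *
        (fundamentalRep (Fin N) (wordHolonomy U x (plaqWord μ ν₀ true).reverse)).trace *
        (fundamentalRep (Fin N) (wordHolonomy U x (plaqWord μ ν₀ true).reverse)).trace
          ∂(wilsonMeasure (d := d) (L := L) (fundamentalRep (Fin N)) β)) := by
    rw [← integral_conj]
    refine integral_congr_ae (ae_of_all _ fun U => ?_)
    dsimp only
    rw [map_mul, map_mul, trace_wordHolonomy_reverse_eq_conj U x _ hP, Complex.conj_conj]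
    ring
  rw [hconj, Complex.norm_conj]
  exact norm_integral_trace_mul_reverse_sq_suN_le hN hL β x hμν₀

/-- ★ **`‖E[tr U_P² · tr U_P⁻¹]‖ ≤ 17N(d−1)|β|`** (`SU(N)`, `N ≥ 2`): from the reverse-spectator identity of the doubly-wound
plaquette `(N − 1/N)E[D t'] + E[t t t'] − E[t] = O(β)` (ADDENDUM 24). [folklore] -/
theorem norm_integral_trace_double_mul_reverse_suN_le (hN : 2 ≤ N) (hL : (1 : ZMod L) ≠ 0) (β : ℝ) (x : Site d L)
    {μ ν₀ : Fin d} (hμν₀ : μ ≠ ν₀) :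
    ‖∫ U, (fundamentalRep (Fin N) (wordHolonomy U x (plaqWord μ ν₀ true ++ plaqWord μ ν₀ true))).trace *
        (fundamentalRep (Fin N) (wordHolonomy U x (plaqWord μ ν₀ true).reverse)).trace
          ∂(wilsonMeasure (d := d) (L := L) (fundamentalRep (Fin N)) β)‖ ≤ 17 * (N : ℝ) * ((d : ℝ) - 1) * |β| := by
  have hN2 : (2 : ℝ) ≤ N := by exact_mod_cast hN
  have hNpos : (0 : ℝ) < N := by linarith
  have hN21 : (0 : ℝ) < (N : ℝ) ^ 2 - 1 := by nlinarith
  have hd1 : (0 : ℝ) ≤ (d : ℝ) - 1 := sub_one_nonneg_of_axis μ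
  have h := doublyWound_reverseSpectator_identity_suN (d := d) (L := L) (N := N) hL β x hμν₀
  have hR := norm_sum_sum_integral_plaqTerm_mul_trace_le (d := d) (L := L) (fundamentalLatticeRep N) β 1 x μ
    (plaqWord μ ν₀ true ++ plaqWord μ ν₀ true) x (plaqWord μ ν₀ true).reverse
  simp only [fundamentalLatticeRep_N, fundamentalLatticeRep_ρ, norm_one] at hR
  set C := ∫ U, (fundamentalRep (Fin N) (wordHolonomy U x (plaqWord μ ν₀ true ++ plaqWord μ ν₀ true))).trace *
        (fundamentalRep (Fin N) (wordHolonomy U x (plaqWord μ ν₀ true).reverse)).trace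
          ∂(wilsonMeasure (d := d) (L := L) (fundamentalRep (Fin N)) β) with hC
  set A := ∫ U, (fundamentalRep (Fin N) (wordHolonomy U x (plaqWord μ ν₀ true))).trace *
        (fundamentalRep (Fin N) (wordHolonomy U x (plaqWord μ ν₀ true))).trace *
        (fundamentalRep (Fin N) (wordHolonomy U x (plaqWord μ ν₀ true).reverse)).trace
          ∂(wilsonMeasure (d := d) (L := L) (fundamentalRep (Fin N)) β) with hA
  set τ := ∫ U, (fundamentalRep (Fin N) (wordHolonomy U x (plaqWord μ ν₀ true))).trace
    ∂(wilsonMeasure (d := d) (L := L) (fundamentalRep (Fin N)) β) with hτ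
  set S := ∑ ν ∈ Finset.univ.erase μ, ∑ ε : Bool,
        ∫ U, plaqTerm (fundamentalRep (Fin N)) 1 x μ U (plaqWord μ ν₀ true ++ plaqWord μ ν₀ true) ν ε *
          (fundamentalRep (Fin N) (wordHolonomy U x (plaqWord μ ν₀ true).reverse)).trace
            ∂(wilsonMeasure (d := d) (L := L) (fundamentalRep (Fin N)) β) with hS
  have h' : ((N : ℂ) - 1 / N) * C + A - τ = -((β / 2 : ℂ) * S) := h
  have hR' : ‖S‖ ≤ ((d : ℝ) - 1) * (2 * (2 * N * (1 + 1) * N)) := hR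
  have hA' := norm_integral_trace_sq_mul_reverse_suN_le (d := d) (L := L) hN hL β x hμν₀
  have hτ' := norm_integral_trace_plaqWord_suN_le (d := d) (L := L) hN hL β x hμν₀
  rw [← hA] at hA'
  rw [← hτ] at hτ'
  have hcoef : ((N : ℂ) - 1 / N) = ((((N : ℝ) ^ 2 - 1) / N : ℝ) : ℂ) := by
    have : (N : ℂ) ≠ 0 := by exact_mod_cast hNpos.ne'
    push_cast; field_simp
  have hid : ((((N : ℝ) ^ 2 - 1) / N : ℝ) : ℂ) * C = τ - A - (β / 2 : ℂ) * S := by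
    rw [← hcoef]; linear_combination h'
  have hn := congrArg (fun z : ℂ => ‖z‖) hid
  simp only [norm_mul, Complex.norm_real, Real.norm_eq_abs, abs_of_pos (by positivity : (0 : ℝ) < ((N : ℝ) ^ 2 - 1) / N)] at hn
  have hle : ((N : ℝ) ^ 2 - 1) / N * ‖C‖ ≤ 4 * ((d : ℝ) - 1) * (N : ℝ) ^ 2 * |β| / ((N : ℝ) ^ 2 - 1) +
      7 * (N : ℝ) ^ 2 * ((d : ℝ) - 1) * |β| + |β| / 2 * (((d : ℝ) - 1) * (2 * (2 * N * (1 + 1) * N))) := by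
    rw [hn]
    refine (norm_sub_le _ _).trans (add_le_add ((norm_sub_le _ _).trans (add_le_add hτ' hA')) ?_)
    rw [norm_mul, norm_half_ofReal]
    exact mul_le_mul_of_nonneg_left hR' (by positivity)
  have hfrac : 4 * ((d : ℝ) - 1) * (N : ℝ) ^ 2 * |β| / ((N : ℝ) ^ 2 - 1) ≤ 4 / 3 * (((d : ℝ) - 1) * (N : ℝ) ^ 2 * |β|) := by
    rw [div_le_iff₀ hN21]
    have h0 : 0 ≤ ((d : ℝ) - 1) * (N : ℝ) ^ 2 * |β| := by positivity
    have hN4 : (0 : ℝ) ≤ (N : ℝ) ^ 2 - 4 := by nlinarith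
    nlinarith [mul_nonneg h0 hN4]
  have hkey : ((N : ℝ) ^ 2 - 1) / N * ‖C‖ ≤ ((N : ℝ) ^ 2 - 1) / N * (17 * (N : ℝ) * ((d : ℝ) - 1) * |β|) := by
    refine hle.trans ?_
    have h0 : 0 ≤ ((d : ℝ) - 1) * (N : ℝ) ^ 2 * |β| := by positivity
    have e : ((N : ℝ) ^ 2 - 1) / N * (17 * (N : ℝ) * ((d : ℝ) - 1) * |β|) =
        (17 - 17 / (N : ℝ) ^ 2) * (((d : ℝ) - 1) * (N : ℝ) ^ 2 * |β|) := by field_simp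
    rw [e]
    have hinv : 17 / (N : ℝ) ^ 2 ≤ 17 / 4 := by
      rw [div_le_div_iff_of_pos_left (by norm_num) (by positivity) (by norm_num)]; nlinarith
    have h4 : 17 / (N : ℝ) ^ 2 * (((d : ℝ) - 1) * (N : ℝ) ^ 2 * |β|) ≤ 17 / 4 * (((d : ℝ) - 1) * (N : ℝ) ^ 2 * |β|) :=
      mul_le_mul_of_nonneg_right hinv h0
    have h2 : |β| / 2 * (((d : ℝ) - 1) * (2 * (2 * N * (1 + 1) * N))) = 4 * (((d : ℝ) - 1) * (N : ℝ) ^ 2 * |β|) := by ring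
    have h3 : 7 * (N : ℝ) ^ 2 * ((d : ℝ) - 1) * |β| = 7 * (((d : ℝ) - 1) * (N : ℝ) ^ 2 * |β|) := by ring
    nlinarith
  exact le_of_mul_le_mul_left hkey (by positivity)

/-! ## The holomorphic sector (`N ≥ 4`): the `2 × 2` elimination -/
omit [NeZero L] in
/-- The `2×2` system `c·κ + 2η = R₁`, `2κ + c·η = R₅` with `c > 2`: `(c² − 4)‖κ‖ ≤ c‖R₁‖ + 2‖R₅‖` and
`(c² − 4)‖η‖ ≤ c‖R₅‖ + 2‖R₁‖`. [folklore] -/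
theorem two_by_two_norm_le {c : ℝ} (hc : 2 < c) {κ η R₁ R₅ : ℂ} (h1 : (c : ℂ) * κ + 2 * η = R₁)
    (h2 : 2 * κ + (c : ℂ) * η = R₅) :
    (c ^ 2 - 4) * ‖κ‖ ≤ c * ‖R₁‖ + 2 * ‖R₅‖ ∧ (c ^ 2 - 4) * ‖η‖ ≤ c * ‖R₅‖ + 2 * ‖R₁‖ := by
  have hc4 : 0 < c ^ 2 - 4 := by nlinarith
  have e1 : ((c ^ 2 - 4 : ℝ) : ℂ) * κ = (c : ℂ) * R₁ - 2 * R₅ := by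
    push_cast; linear_combination (c : ℂ) * h1 - 2 * h2
  have e2 : ((c ^ 2 - 4 : ℝ) : ℂ) * η = (c : ℂ) * R₅ - 2 * R₁ := by
    push_cast; linear_combination (c : ℂ) * h2 - 2 * h1
  have n1 := congrArg (fun z : ℂ => ‖z‖) e1
  have n2 := congrArg (fun z : ℂ => ‖z‖) e2
  simp only [norm_mul, Complex.norm_real, Real.norm_eq_abs, abs_of_pos hc4] at n1 n2
  have hcn : ‖(c : ℂ)‖ = c := by rw [Complex.norm_real, Real.norm_eq_abs, abs_of_pos (by linarith)]
  constructor
  · rw [n1]; refine (norm_sub_le _ _).trans (le_of_eq ?_); rw [norm_mul, norm_mul, hcn, Complex.norm_ofNat]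
  · rw [n2]; refine (norm_sub_le _ _).trans (le_of_eq ?_); rw [norm_mul, norm_mul, hcn, Complex.norm_ofNat]

omit [NeZero L] in
/-- `10N⁴ − 152N² + 126 ≥ 0` for `N ≥ 4` (rounding of the `κ` bound). [folklore] -/
theorem poly_aux₁ (N : ℝ) (hN : 4 ≤ N) : 4 * (N ^ 2 - 3) * N ^ 2 + 24 * N ^ 2 ≤ 14 * (N ^ 2 - 3) ^ 2 - 56 * N ^ 2 := by
  have h16 : 0 ≤ N ^ 2 - 16 := by nlinarith
  nlinarith [mul_nonneg (sq_nonneg N) h16]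

omit [NeZero L] in
/-- `29N⁴ − 454N² + 441 ≥ 0` for `N ≥ 4` (rounding of the `η` bound). [folklore] -/
theorem poly_aux₂ (N : ℝ) (hN : 4 ≤ N) : 12 * (N ^ 2 - 3) * N ^ 2 + 8 * N ^ 4 ≤ 49 * (N ^ 2 - 3) ^ 2 - 196 * N ^ 2 := by
  have h16 : 0 ≤ N ^ 2 - 16 := by nlinarith
  nlinarith [mul_nonneg (sq_nonneg N) h16]

/-- ★★ **ALL HOLOMORPHIC CUBIC MOMENTS OF THE `SU(N)` PLAQUETTE ARE `O(β)` FOR `N ≥ 4`** (every `L ≥ 2`, every real `β`):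
`‖E[(tr U_P)³]‖ ≤ 14N²(d−1)|β|`, `‖E[tr U_P² · tr U_P]‖ ≤ 49N(d−1)|β|`, `‖E[tr U_P³]‖ ≤ 27N²(d−1)|β|`.  The three
third-level rows (`c = N − 3/N`): `c·κ + 2η = O(β)` (two spectators `P̃₀`), `c·η + κ + θ = O(β)` (doubly-wound word,
spectator `P̃₀`), `c·η + 2θ = O(β)` (spectator `P̃₀P̃₀`), with determinant `c² − 4 = (N² − 1)(N² − 9)/N² > 0`.  (For
`SU(3)` the determinant vanishes: `κ = 1 + O(β)`, ADDENDUM 24.) [folklore] -/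
theorem cubicMoments_suN_le (hN : 4 ≤ N) (hL : (1 : ZMod L) ≠ 0) (β : ℝ) (x : Site d L) {μ ν₀ : Fin d} (hμν₀ : μ ≠ ν₀) :
    ‖∫ U, (fundamentalRep (Fin N) (wordHolonomy U x (plaqWord μ ν₀ true))).trace *
        (fundamentalRep (Fin N) (wordHolonomy U x (plaqWord μ ν₀ true))).trace *
        (fundamentalRep (Fin N) (wordHolonomy U x (plaqWord μ ν₀ true))).trace
          ∂(wilsonMeasure (d := d) (L := L) (fundamentalRep (Fin N)) β)‖ ≤ 14 * (N : ℝ) ^ 2 * ((d : ℝ) - 1) * |β| ∧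
    ‖∫ U, (fundamentalRep (Fin N) (wordHolonomy U x (plaqWord μ ν₀ true ++ plaqWord μ ν₀ true))).trace *
        (fundamentalRep (Fin N) (wordHolonomy U x (plaqWord μ ν₀ true))).trace
          ∂(wilsonMeasure (d := d) (L := L) (fundamentalRep (Fin N)) β)‖ ≤ 49 * (N : ℝ) * ((d : ℝ) - 1) * |β| ∧
    ‖∫ U, (fundamentalRep (Fin N) (wordHolonomy U x (plaqWord μ ν₀ true ++ plaqWord μ ν₀ true)) *
        fundamentalRep (Fin N) (wordHolonomy U x (plaqWord μ ν₀ true))).trace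
          ∂(wilsonMeasure (d := d) (L := L) (fundamentalRep (Fin N)) β)‖ ≤ 27 * (N : ℝ) ^ 2 * ((d : ℝ) - 1) * |β| := by
  have hN4 : (4 : ℝ) ≤ N := by exact_mod_cast hN
  have hNpos : (0 : ℝ) < N := by linarith
  have hd1 : (0 : ℝ) ≤ (d : ℝ) - 1 := sub_one_nonneg_of_axis μ
  -- the three rows
  have h1 := twoSpectators_self_identity (d := d) (L := L) (fundamentalLatticeRep N) hL β x hμν₀ 1
    fun i j => sdPairMany_specialUnitaryGroup N β x μ x _ _ _ continuous_const (fun _ _ => rfl) _ (trace_unitDir_one i j)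
  have h2 := doublyWound_spectator_identity_suN (d := d) (L := L) (N := N) hL β x hμν₀
  have h3 := doubleSpectator_identity (d := d) (L := L) (fundamentalLatticeRep N) hL β x hμν₀ 1
    fun i j => sdPair₂_specialUnitaryGroup N β x μ x _ x _ _ (trace_unitDir_one i j)
  have hR1 := norm_sum_sum_integral_plaqTerm_mul_mul_le (d := d) (L := L) (fundamentalLatticeRep N) β 1 x μ
    (plaqWord μ ν₀ true) x (plaqWord μ ν₀ true) x (plaqWord μ ν₀ true)
  have hR2 := norm_sum_sum_integral_plaqTerm_mul_trace_le (d := d) (L := L) (fundamentalLatticeRep N) β 1 x μ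
    (plaqWord μ ν₀ true ++ plaqWord μ ν₀ true) x (plaqWord μ ν₀ true)
  have hR3 := norm_sum_sum_integral_plaqTerm_mul_trace_le (d := d) (L := L) (fundamentalLatticeRep N) β 1 x μ
    (plaqWord μ ν₀ true) x (plaqWord μ ν₀ true ++ plaqWord μ ν₀ true)
  simp only [fundamentalLatticeRep_N, fundamentalLatticeRep_ρ, norm_one] at h1 h3 hR1 hR2 hR3
  set κ := ∫ U, (fundamentalRep (Fin N) (wordHolonomy U x (plaqWord μ ν₀ true))).trace *
        (fundamentalRep (Fin N) (wordHolonomy U x (plaqWord μ ν₀ true))).trace *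
        (fundamentalRep (Fin N) (wordHolonomy U x (plaqWord μ ν₀ true))).trace
          ∂(wilsonMeasure (d := d) (L := L) (fundamentalRep (Fin N)) β) with hκ
  set η := ∫ U, (fundamentalRep (Fin N) (wordHolonomy U x (plaqWord μ ν₀ true ++ plaqWord μ ν₀ true))).trace *
        (fundamentalRep (Fin N) (wordHolonomy U x (plaqWord μ ν₀ true))).trace
          ∂(wilsonMeasure (d := d) (L := L) (fundamentalRep (Fin N)) β) with hη
  set θ := ∫ U, (fundamentalRep (Fin N) (wordHolonomy U x (plaqWord μ ν₀ true ++ plaqWord μ ν₀ true)) *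
        fundamentalRep (Fin N) (wordHolonomy U x (plaqWord μ ν₀ true))).trace
          ∂(wilsonMeasure (d := d) (L := L) (fundamentalRep (Fin N)) β) with hθ
  set S₁ := ∑ ν ∈ Finset.univ.erase μ, ∑ ε : Bool,
        ∫ U, plaqTerm (fundamentalRep (Fin N)) 1 x μ U (plaqWord μ ν₀ true) ν ε *
          ((fundamentalRep (Fin N) (wordHolonomy U x (plaqWord μ ν₀ true))).trace *
          (fundamentalRep (Fin N) (wordHolonomy U x (plaqWord μ ν₀ true))).trace)
            ∂(wilsonMeasure (d := d) (L := L) (fundamentalRep (Fin N)) β) with hS₁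
  set S₂ := ∑ ν ∈ Finset.univ.erase μ, ∑ ε : Bool,
        ∫ U, plaqTerm (fundamentalRep (Fin N)) 1 x μ U (plaqWord μ ν₀ true ++ plaqWord μ ν₀ true) ν ε *
          (fundamentalRep (Fin N) (wordHolonomy U x (plaqWord μ ν₀ true))).trace
            ∂(wilsonMeasure (d := d) (L := L) (fundamentalRep (Fin N)) β) with hS₂
  set S₃ := ∑ ν ∈ Finset.univ.erase μ, ∑ ε : Bool,
        ∫ U, plaqTerm (fundamentalRep (Fin N)) 1 x μ U (plaqWord μ ν₀ true) ν ε *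
          (fundamentalRep (Fin N) (wordHolonomy U x (plaqWord μ ν₀ true ++ plaqWord μ ν₀ true))).trace
            ∂(wilsonMeasure (d := d) (L := L) (fundamentalRep (Fin N)) β) with hS₃
  have h1' : ((N : ℂ) - 3 * 1 / N) * κ + 2 * η = -((β / 2 : ℂ) * S₁) := h1
  have h2' : ((N : ℂ) - 3 / N) * η + κ + θ = -((β / 2 : ℂ) * S₂) := h2
  have h3' : ((N : ℂ) - 3 * 1 / N) * η + 2 * θ = -((β / 2 : ℂ) * S₃) := h3
  have hR1' : ‖S₁‖ ≤ ((d : ℝ) - 1) * (2 * (2 * N * (1 + 1) * N * N)) := hR1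
  have hR2' : ‖S₂‖ ≤ ((d : ℝ) - 1) * (2 * (2 * N * (1 + 1) * N)) := hR2
  have hR3' : ‖S₃‖ ≤ ((d : ℝ) - 1) * (2 * (2 * N * (1 + 1) * N)) := hR3
  -- the coefficient `c = (N² − 3)/N`
  set c : ℝ := ((N : ℝ) ^ 2 - 3) / N with hc
  have hcN : c * N = (N : ℝ) ^ 2 - 3 := by rw [hc]; field_simp
  have hc2 : 2 < c := by
    rw [hc, lt_div_iff₀ hNpos]; nlinarith
  have hcpos : 0 < c := by linarith
  have hc4 : 0 < c ^ 2 - 4 := by nlinarith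
  have hcC : ((N : ℂ) - 3 * 1 / N) = (c : ℂ) := by
    have : (N : ℂ) ≠ 0 := by exact_mod_cast hNpos.ne'
    rw [hc]; push_cast; field_simp
  have hcC' : ((N : ℂ) - 3 / N) = (c : ℂ) := by rw [← hcC]; ring
  rw [hcC] at h1' h3'
  rw [hcC'] at h2'
  have h5 : 2 * κ + (c : ℂ) * η = -((β / 2 : ℂ) * (2 * S₂ - S₃)) := by linear_combination 2 * h2' - h3'
  obtain ⟨hκb, hηb⟩ := two_by_two_norm_le hc2 h1' h5
  -- norms of the right sides
  have hβ2 : ‖(β / 2 : ℂ)‖ = |β| / 2 := norm_half_ofReal β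
  have nR1 : ‖-((β / 2 : ℂ) * S₁)‖ ≤ |β| / 2 * (((d : ℝ) - 1) * (2 * (2 * N * (1 + 1) * N * N))) := by
    rw [norm_neg, norm_mul, hβ2]; exact mul_le_mul_of_nonneg_left hR1' (by positivity)
  have nR5 : ‖-((β / 2 : ℂ) * (2 * S₂ - S₃))‖ ≤ |β| / 2 * (2 * (((d : ℝ) - 1) * (2 * (2 * N * (1 + 1) * N))) +
      ((d : ℝ) - 1) * (2 * (2 * N * (1 + 1) * N))) := by
    rw [norm_neg, norm_mul, hβ2]
    refine mul_le_mul_of_nonneg_left ((norm_sub_le _ _).trans (add_le_add ?_ hR3')) (by positivity)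
    rw [norm_mul, Complex.norm_ofNat]; exact mul_le_mul_of_nonneg_left hR2' (by norm_num)
  have nR3 : ‖-((β / 2 : ℂ) * S₃)‖ ≤ |β| / 2 * (((d : ℝ) - 1) * (2 * (2 * N * (1 + 1) * N))) := by
    rw [norm_neg, norm_mul, hβ2]; exact mul_le_mul_of_nonneg_left hR3' (by positivity)
  -- abbreviate `Y = (d−1)|β|`
  have hY : 0 ≤ ((d : ℝ) - 1) * |β| := by positivity
  have hκ1 : (c ^ 2 - 4) * ‖κ‖ ≤ (4 * c * (N : ℝ) ^ 3 + 24 * (N : ℝ) ^ 2) * (((d : ℝ) - 1) * |β|) := by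
    refine hκb.trans ?_
    have := add_le_add (mul_le_mul_of_nonneg_left nR1 hcpos.le) (mul_le_mul_of_nonneg_left nR5 (by norm_num : (0:ℝ) ≤ 2))
    refine this.trans (le_of_eq ?_); ring
  have hη1 : (c ^ 2 - 4) * ‖η‖ ≤ (12 * c * (N : ℝ) ^ 2 + 8 * (N : ℝ) ^ 3) * (((d : ℝ) - 1) * |β|) := by
    refine hηb.trans ?_
    have := add_le_add (mul_le_mul_of_nonneg_left nR5 hcpos.le) (mul_le_mul_of_nonneg_left nR1 (by norm_num : (0:ℝ) ≤ 2))
    refine this.trans (le_of_eq ?_); ring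
  -- rounding: polynomial inequalities in `N ≥ 4` (use `cN = N² − 3`)
  have hpoly1 : 4 * c * (N : ℝ) ^ 3 + 24 * (N : ℝ) ^ 2 ≤ (c ^ 2 - 4) * (14 * (N : ℝ) ^ 2) := by
    rw [show 4 * c * (N : ℝ) ^ 3 = 4 * (c * N) * (N : ℝ) ^ 2 by ring,
      show (c ^ 2 - 4) * (14 * (N : ℝ) ^ 2) = 14 * (c * N) ^ 2 - 56 * (N : ℝ) ^ 2 by ring, hcN]
    exact poly_aux₁ N hN4
  have hpoly2 : 12 * c * (N : ℝ) ^ 2 + 8 * (N : ℝ) ^ 3 ≤ (c ^ 2 - 4) * (49 * (N : ℝ)) := by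
    -- multiply by `N > 0`: `20N⁴ − 36N² ≤ 49(N⁴ − 10N² + 9)`
    rw [← mul_le_mul_iff_of_pos_right hNpos]
    rw [show (12 * c * (N : ℝ) ^ 2 + 8 * (N : ℝ) ^ 3) * N = 12 * (c * N) * (N : ℝ) ^ 2 + 8 * (N : ℝ) ^ 4 by ring,
      show (c ^ 2 - 4) * (49 * (N : ℝ)) * N = 49 * (c * N) ^ 2 - 196 * (N : ℝ) ^ 2 by ring, hcN]
    exact poly_aux₂ N hN4
  have hκ2 : ‖κ‖ ≤ 14 * (N : ℝ) ^ 2 * ((d : ℝ) - 1) * |β| := by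
    have h := hκ1.trans (mul_le_mul_of_nonneg_right hpoly1 hY)
    rw [mul_assoc] at h
    have h' := le_of_mul_le_mul_left h hc4
    refine h'.trans (le_of_eq ?_); ring
  have hη2 : ‖η‖ ≤ 49 * (N : ℝ) * ((d : ℝ) - 1) * |β| := by
    have h := hη1.trans (mul_le_mul_of_nonneg_right hpoly2 hY)
    rw [mul_assoc] at h
    have h' := le_of_mul_le_mul_left h hc4
    refine h'.trans (le_of_eq ?_); ring
  refine ⟨hκ2, hη2, ?_⟩
  -- `2θ = −(β/2)S₃ − cη`
  have hθid : (2 : ℂ) * θ = -((β / 2 : ℂ) * S₃) - (c : ℂ) * η := by linear_combination h3'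
  have hn := congrArg (fun z : ℂ => ‖z‖) hθid
  simp only [norm_mul, Complex.norm_ofNat] at hn
  have hcn : ‖(c : ℂ)‖ = c := by rw [Complex.norm_real, Real.norm_eq_abs, abs_of_pos hcpos]
  have h2θ : 2 * ‖θ‖ ≤ |β| / 2 * (((d : ℝ) - 1) * (2 * (2 * N * (1 + 1) * N))) + c * (49 * (N : ℝ) * ((d : ℝ) - 1) * |β|) := by
    rw [hn]
    refine (norm_sub_le _ _).trans (add_le_add nR3 ?_)
    rw [norm_mul, hcn]; exact mul_le_mul_of_nonneg_left hη2 hcpos.le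
  have hcY : c * (49 * (N : ℝ) * ((d : ℝ) - 1) * |β|) = 49 * (c * N) * (((d : ℝ) - 1) * |β|) := by ring
  rw [hcY, hcN] at h2θ
  have e4 : |β| / 2 * (((d : ℝ) - 1) * (2 * (2 * N * (1 + 1) * N))) = 4 * (N : ℝ) ^ 2 * (((d : ℝ) - 1) * |β|) := by ring
  rw [e4] at h2θ
  have hY2 : 0 ≤ (N : ℝ) ^ 2 * (((d : ℝ) - 1) * |β|) := by positivity
  nlinarith
end StrongCoupling

end Summit.QuantumFields.GaugeBoot

end
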